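import Summits.BirchSwinnertonDyer.BirchSwinnertonDyer.Theorems.GenusKolyvaginAtTwoPowDvdShaCardAtTwoRTGenusIndexRegulator
import Summits.BirchSwinnertonDyer.BirchSwinnertonDyer.Theorems.GenusKolyvaginAtTwoPowDvdShaCardAtTwoRTGenusIndexLocal
import Literature.NumberTheory.EllipticCurves.TwoTorsionOddDegreeBaseChangeProofs
import Literature.NumberTheory.EllipticCurves.BSDSelmerPConverseYanZhuKolyvaginSystemProofs
import Literature.NumberTheory.EllipticCurves.HeegnerPointsOfConductorOneGaloisConjProofs
import Literature.NumberTheory.EllipticCurves.GlobalMinimalModelHeegnerBaseChangeProofs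
import Literature.NumberTheory.EllipticCurves.Milne1972.WeilRestrictionQuadraticBSDQuotientOfAnyModelProofs
import Literature.NumberTheory.EllipticCurves.RegulatorProofs
import Literature.NumberTheory.EllipticCurves.ComplexPeriodProofs
import Literature.NumberTheory.EllipticCurves.TamagawaFiniteIndexProofs
import Literature.NumberTheory.EllipticCurves.MordellWeilProofs
import HarnessLib

/-!
# Route `GenusKolyvaginAtTwo`, LINE 18 v4 (L_T `PowDvdShaCardAtTwoRT`, stmt-BirchSwinnertonDyer-23242):
# registered stub K `stub_genusIndexLaw` — THE GENUS INDEX LAW `ord₂ ρ = ord₂ C(Wd) − 1`,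
# PROVED MODULO the named fact `kolyvagin` (Kolyvagin's theorem, Gross 1991 Thm. 1.3: the SAME print
# antecedent as stub 3b″ `stub_milneDefect`, tree `…MilneDefect.lean`)

Seat `bsd-line-gk2-p2` g14 (cell `bsd-f1-sign2`), `--supports stmt-BirchSwinnertonDyer-23242` (helper; closes
nothing — the stub is obtained behind ONE displayed PRINT antecedent, a CONDITIONAL result, D-0014).  THEOREMS
ONLY (no definition, no new named fact, no `sorry`); BSD is not proved by any of this.

The stub (pen `bsd-idea-1` g11, skeleton v4 `plus_descent.lean` of 2026-08-28T23:12Z, idea-crit-5 VERDICT #184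
price (β) «the index identity as a SEPARATE print stub»): on the `Δ < 0` genus frame (odd Tamagawa, `K` imaginary
quadratic with odd `d_K ≠ −3` and the Heegner hypothesis, `ρ_{E,2^n}` onto, `y_1` of infinite order) and for
any globally minimal model `Wd` of `E^{(d_K)}`, the Ш-free Birch–Swinnerton-Dyer ratio
`ρ = B(W)·B(Wd)/B(W_K)`, `B(X) = Reg(X)·Ω(X)·C(X)/#X_tors²` (`regulator`, `bsdPeriod`, `modifiedTamagawaProduct`,
`torsionOrder`), is a non-zero rational `q` with **`ord₂ q = ord₂ C(Wd) − 1`**.  Proof = the four factors: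

* (R) `Reg(W)·Reg(Wd) = Reg(W_K)/2` (`regulator_mul_regulator_eq_half_of_twist`, file `…GenusIndexRegulator`:
  `rank E(K) = 1` — HERE from Kolyvagin's theorem on `y_1` — and `E(K)[2] = 0` from `ρ_{E,2}` onto,
  Dokchitser–Dokchitser 2012 (1), tree `forall_two_nsmul_baseChange_of_hasSurjectiveModNGaloisRep_two_…`);
* (Ω) `Ω(W)·Ω(Wd) = Ω(W_K/K)` (`bsdPeriod_mul_bsdPeriod_twin_eq`, file `…GenusIndexLocal`: `Δ < 0`, Pal's `ũ = 1`);
* (C) `C = ∏ c` on the three globally minimal models, `C(W)` odd (hypothesis), `C(W_K) = C(W)²` odd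
  (`tamagawaProduct_baseChange_eq_sq_of_heegner`); `C(Wd)` stays symbolic;
* (T) `#W(ℚ)_tors`, `#Wd(ℚ)_tors`, `#W(K)_tors` odd (no `2`-torsion: `ρ_{E,2}` onto; `Wd(ℚ) ↪ W^{(d_K)}(ℚ) ↪ E(K)`).
Hence `q = C(W)·C(Wd)·#W(K)_tors² / (2·C(W_K)·#W(ℚ)_tors²·#Wd(ℚ)_tors²)` and `ord₂ q = ord₂ C(Wd) − 1`.

* `genusIndexLaw_of_rank_one` — the law with `rank_ℤ E(K) = 1` and `ρ_{E,2}` onto as hypotheses (UNCONDITIONAL);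
* `stub_genusIndexLaw_of_kolyvagin` — the LINE 18 v4 stub signature VERBATIM behind
  `∀ N W K, kolyvagin N W K` (same binder as `stub_milneDefect_of_facts`); the stub's `d_K ≠ −3`, `Dt`, `β`, `ι`
  binders are consumed only through Kolyvagin (`y_1 = P(1)` non-torsion ⇒ rank one).

With the pen's composition `PowDvdShaCardAtTwoRT_of_stubs` this leaves L_T resting on 3a‴ `stub_twinLadderGenus`
(the lever) plus the two print facts `kolyvagin`, `Milne1972.bsdQuotient_baseChange_quadratic_anyModel` already
displayed by 3b″ — stub K adds NO antecedent.  References: [DokchitserDokchitserAnnals2010] Conj. 2.1;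
[Kramer1981] Prop. 3, Thm. 1; [Pal2012] Prop. 2.5; [GrossLMS1991] §1 (1.2), Thm. 1.3; [SilvermanAEC2009] VIII.5.4(b),
VIII.9, Exercise 10.16; [Milne1972ArithmeticAV] §1.
-/

set_option autoImplicit false
-- the Theorems namespace of this sub repeats the summit name by design (D-0017 nested layout)
set_option linter.dupNamespace false

noncomputable section

open scoped Classical

namespace Summit.BirchSwinnertonDyer.BirchSwinnertonDyer.Theorems.GenusExact.PlusDescent

open WeierstrassCurve NumberField Literature.NumberTheory.EllipticCurves
  Literature.NumberTheory.EllipticCurves.ModularForms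

/-- **THE GENUS INDEX LAW with `rank E(K) = 1` as a hypothesis (UNCONDITIONAL).**  `W/ℚ` globally minimal
elliptic with odd `∏ c_ℓ` and `Δ < 0`; `K` imaginary quadratic with odd `d_K` satisfying the Heegner hypothesis for
`N_W`; `ρ_{E,2}` onto; `rank_ℤ E(K) = 1`; `Wd` a globally minimal model of `E^{(d_K)}`.  Then
`ρ = B(W)·B(Wd)/B(W_K)` is the rational `q = C(W)·C(Wd)·#E(K)_tors² / (2·C(W_K)·#E(ℚ)_tors²·#Wd(ℚ)_tors²) ≠ 0`
and `ord₂ q = ord₂ C(Wd) − 1` (the four bullets (R), (Ω), (C), (T) of the module docstring).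
[cite: DokchitserDokchitserAnnals2010, Conj. 2.1] [cite: Kramer1981, Prop. 3 and Thm. 1] [cite: Pal2012, Prop. 2.5]
[cite: GrossLMS1991, §1 (1.2)] [cite: SilvermanAEC2009, Exercise 10.16 and VIII.9] -/
theorem genusIndexLaw_of_rank_one (W : WeierstrassCurve ℚ) [W.IsElliptic] [W.IsGloballyMinimal]
    (hT : Odd W.tamagawaProduct) (hΔ : W.Δ < 0) (K : Type) [Field K] [NumberField K]
    (hK : IsImaginaryQuadratic K) (hodd : Odd (NumberField.discr K))
    (hH : SatisfiesHeegnerHypothesis (W.conductorNorm ℤ) K) (hρ : W.HasSurjectiveModNGaloisRep 2)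
    (hrank : (W.baseChange K).mordellWeilRank = 1)
    (Wd : WeierstrassCurve ℚ) [Wd.IsElliptic] [Wd.IsGloballyMinimal]
    (hWd : ∃ C : WeierstrassCurve.VariableChange ℚ, C • W.quadraticTwist (NumberField.discr K : ℚ) = Wd) :
    ∃ q : ℚ, q ≠ 0 ∧ (q : ℝ) = (W.regulator * W.bsdPeriod * ((W.modifiedTamagawaProduct : ℚ) : ℝ) / ((W.torsionOrder : ℕ) : ℝ) ^ 2) * (Wd.regulator * Wd.bsdPeriod * ((Wd.modifiedTamagawaProduct : ℚ) : ℝ) / ((Wd.torsionOrder : ℕ) : ℝ) ^ 2) / ((W.baseChange K).regulator * (W.baseChange K).bsdPeriod * (((W.baseChange K).modifiedTamagawaProduct : ℚ) : ℝ) / (((W.baseChange K).torsionOrder : ℕ) : ℝ) ^ 2) ∧ padicValRat 2 q = (padicValNat 2 Wd.tamagawaProduct : ℤ) - 1 := by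
  -- pin the decidability instance on `ℚ` to the classical one carried by the generic-field lemmas
  letI hdec : DecidableEq ℚ := fun a b => Classical.propDecidable (a = b)
  obtain ⟨C, hC⟩ := hWd
  have h2 : Module.finrank ℚ K = 2 := hK.1
  haveI hEK : (W.baseChange K).IsElliptic := by rw [WeierstrassCurve.baseChange]; infer_instance
  have hd0 : (NumberField.discr K : ℚ) ≠ 0 := by exact_mod_cast NumberField.discr_ne_zero K
  haveI := W.isElliptic_quadraticTwist hd0
  -- (T) no `2`-torsion and odd torsion orders
  have htK : ∀ P : (W.baseChange K).toAffine.Point, 2 • P = 0 → P = 0 :=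
    forall_two_nsmul_baseChange_of_hasSurjectiveModNGaloisRep_two_of_isImaginaryQuadratic W hρ K hK
  have htWd : ∀ P : Wd.toAffine.Point, 2 • P = 0 → P = 0 := by
    intro P hP
    set e := (VariableChange.pointEquiv (W.quadraticTwist (NumberField.discr K : ℚ)) C).trans
      (Affine.Point.congrEquiv hC) with he
    have h := forall_two_nsmul_eq_zero_quadraticTwist_discr W K h2 htK (e.symm P)
      (by rw [← map_nsmul, hP, map_zero])
    simpa using congrArg e h
  have hoW : Odd W.torsionOrder := odd_torsionOrder_of_hasSurjectiveModNGaloisRep_two W hρ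
  have hoWd : Odd Wd.torsionOrder := odd_torsionOrder_of_forall_two_nsmul Wd htWd
  have hoK : Odd (W.baseChange K).torsionOrder :=
    odd_torsionOrder_baseChange_of_hasSurjectiveModNGaloisRep_two_of_isImaginaryQuadratic W hρ K hK
  -- (C) Tamagawa products on the three globally minimal models
  have hCK : (W.baseChange K).tamagawaProduct = W.tamagawaProduct ^ 2 :=
    tamagawaProduct_baseChange_eq_sq_of_heegner W K h2 hH
  have hoCK : Odd (W.baseChange K).tamagawaProduct := by rw [hCK]; exact hT.pow
  have hmW : W.modifiedTamagawaProduct = (W.tamagawaProduct : ℚ) :=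
    modifiedTamagawaProduct_eq_tamagawaProduct_of_isGloballyMinimal W
  have hmWd : Wd.modifiedTamagawaProduct = (Wd.tamagawaProduct : ℚ) :=
    modifiedTamagawaProduct_eq_tamagawaProduct_of_isGloballyMinimal Wd
  have hmK : (W.baseChange K).modifiedTamagawaProduct = ((W.baseChange K).tamagawaProduct : ℚ) :=
    modifiedTamagawaProduct_baseChange_eq_tamagawaProduct_of_isImaginaryQuadratic W hK hH
  -- (R) and (Ω)
  have hR : W.regulator * Wd.regulator = (W.baseChange K).regulator / 2 :=
    regulator_mul_regulator_eq_half_of_twist W K h2 hrank htK Wd hC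
  have hΩ : W.bsdPeriod * Wd.bsdPeriod = (W.baseChange K).bsdPeriod :=
    bsdPeriod_mul_bsdPeriod_twin_eq W K hΔ hK hodd hH Wd ⟨C, hC⟩
  -- positivity
  have hRW : 0 < W.regulator := W.regulator_pos'
  have hRWd : 0 < Wd.regulator := Wd.regulator_pos'
  have hRK : 0 < (W.baseChange K).regulator := (W.baseChange K).regulator_pos'
  have hΩW : 0 < W.bsdPeriod := W.bsdPeriod_pos'
  have hΩWd : 0 < Wd.bsdPeriod := Wd.bsdPeriod_pos'
  have hΩK : 0 < (W.baseChange K).bsdPeriod := (W.baseChange K).bsdPeriod_pos'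
  have hTW : 0 < W.torsionOrder := W.torsionOrder_pos_holds
  have hTWd : 0 < Wd.torsionOrder := Wd.torsionOrder_pos_holds
  have hTK : 0 < (W.baseChange K).torsionOrder := (W.baseChange K).torsionOrder_pos_holds
  have hCW : 0 < W.tamagawaProduct := W.tamagawaProduct_pos_holds
  have hCWd : 0 < Wd.tamagawaProduct := Wd.tamagawaProduct_pos_holds
  have hCKpos : 0 < (W.baseChange K).tamagawaProduct := (W.baseChange K).tamagawaProduct_pos_holds
  -- the rational value
  set a : ℕ := W.tamagawaProduct * Wd.tamagawaProduct * (W.baseChange K).torsionOrder ^ 2 with ha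
  set b : ℕ := 2 * (W.baseChange K).tamagawaProduct * W.torsionOrder ^ 2 * Wd.torsionOrder ^ 2 with hb
  have ha0 : a ≠ 0 := by positivity
  have hb0 : b ≠ 0 := by positivity
  refine ⟨(a : ℚ) / (b : ℚ), div_ne_zero (by exact_mod_cast ha0) (by exact_mod_cast hb0), ?_, ?_⟩
  · -- the identity of real numbers
    have hRK' : (W.baseChange K).regulator = 2 * (W.regulator * Wd.regulator) := by rw [hR]; ring
    rw [hmW, hmWd, hmK, hRK', ← hΩ, ha, hb]
    push_cast
    have h1 : (W.torsionOrder : ℝ) ≠ 0 := by positivity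
    have h2' : (Wd.torsionOrder : ℝ) ≠ 0 := by positivity
    have h3 : ((W.baseChange K).torsionOrder : ℝ) ≠ 0 := by positivity
    have h4 : ((W.baseChange K).tamagawaProduct : ℝ) ≠ 0 := by positivity
    have h5 : W.regulator ≠ 0 := hRW.ne'
    have h6 : Wd.regulator ≠ 0 := hRWd.ne'
    have h7 : W.bsdPeriod ≠ 0 := hΩW.ne'
    have h8 : Wd.bsdPeriod ≠ 0 := hΩWd.ne'
    field_simp
  · -- the `2`-adic valuation
    haveI : Fact (Nat.Prime 2) := ⟨Nat.prime_two⟩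
    have hv : ∀ {n : ℕ}, Odd n → padicValNat 2 n = 0 := fun h =>
      padicValNat.eq_zero_of_not_dvd h.not_two_dvd_nat
    have n1 : W.tamagawaProduct ≠ 0 := hCW.ne'
    have n2 : Wd.tamagawaProduct ≠ 0 := hCWd.ne'
    have n3 : (W.baseChange K).torsionOrder ^ 2 ≠ 0 := pow_ne_zero _ hTK.ne'
    have n12 : W.tamagawaProduct * Wd.tamagawaProduct ≠ 0 := mul_ne_zero n1 n2
    have n4 : (2 : ℕ) ≠ 0 := two_ne_zero
    have n5 : (W.baseChange K).tamagawaProduct ≠ 0 := hCKpos.ne'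
    have n6 : W.torsionOrder ^ 2 ≠ 0 := pow_ne_zero _ hTW.ne'
    have n7 : Wd.torsionOrder ^ 2 ≠ 0 := pow_ne_zero _ hTWd.ne'
    have n45 : 2 * (W.baseChange K).tamagawaProduct ≠ 0 := mul_ne_zero n4 n5
    have n456 : 2 * (W.baseChange K).tamagawaProduct * W.torsionOrder ^ 2 ≠ 0 := mul_ne_zero n45 n6
    have haQ : (a : ℚ) ≠ 0 := by exact_mod_cast ha0
    have hbQ : (b : ℚ) ≠ 0 := by exact_mod_cast hb0
    rw [padicValRat.div haQ hbQ, padicValRat.of_nat, padicValRat.of_nat, ha, hb,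
      padicValNat.mul n12 n3, padicValNat.mul n1 n2, padicValNat.mul n456 n7, padicValNat.mul n45 n6,
      padicValNat.mul n4 n5, padicValNat.pow, padicValNat.pow, padicValNat.pow, hv hT, hv hoK, hv hoCK, hv hoW,
      hv hoWd, padicValNat_self]
    push_cast
    ring

/-- **LINE 18 v4 stub K `stub_genusIndexLaw` (L_T `PowDvdShaCardAtTwoRT`, stmt-23242) PROVED MODULO `kolyvagin`.**
The stub signature VERBATIM behind the print antecedent `∀ N W K, kolyvagin N W K` (Kolyvagin's theorem, Gross
1991 Thm. 1.3; the same binder as `stub_milneDefect_of_facts`): the frame's `y_1 = P(1)` descends to a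
non-torsion Heegner point `P₀ ∈ E(K)` (`heegnerSystem_exists_isHeegnerPoint_map_eq_derivedPoint_one`), Kolyvagin
gives `rank_ℤ E(K) = 1`, `ρ_{E,2}` onto is the `n = 1` instance of the 2-adic tower binder, and
`genusIndexLaw_of_rank_one` concludes.  CONDITIONAL on the named fact `kolyvagin` (closes nothing).
[cite: GrossLMS1991, Thm. 1.3] [cite: DokchitserDokchitserAnnals2010, Conj. 2.1] [cite: Kramer1981, Prop. 3 and Thm. 1]
[cite: Pal2012, Prop. 2.5] -/
theorem stub_genusIndexLaw_of_kolyvagin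
    (hKo : ∀ (N : ℕ) [NeZero N] (W : WeierstrassCurve ℚ) (K : Type) [Field K] [NumberField K],
      kolyvagin N W K) :
    ∀ (W : WeierstrassCurve ℚ) [W.IsElliptic] [W.IsGloballyMinimal] [NeZero (W.conductorNorm ℤ)], Odd W.tamagawaProduct → W.Δ < 0 → ∀ (K : Type) [Field K] [NumberField K], Literature.NumberTheory.EllipticCurves.IsImaginaryQuadratic K → Odd (NumberField.discr K) → NumberField.discr K ≠ -3 → Literature.NumberTheory.EllipticCurves.SatisfiesHeegnerHypothesis (W.conductorNorm ℤ) K → (∀ n : ℕ, 0 < n → W.HasSurjectiveModNGaloisRep ((2 : ℤ) ^ n)) → ∀ (Dt : Literature.NumberTheory.EllipticCurves.ModularForms.ModularParametrizationData W (W.conductorNorm ℤ)) (β : ℤ) (ι : K →+* ℂ) (d₁ : Literature.NumberTheory.EllipticCurves.KolyvaginHeegnerData Dt β ι 1), ¬ IsOfFinAddOrder d₁.derivedPoint → ∀ (Wd : WeierstrassCurve ℚ) [Wd.IsElliptic] [Wd.IsGloballyMinimal], (∃ C : WeierstrassCurve.VariableChange ℚ, C • W.quadraticTwist (NumberField.discr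 K : ℚ) = Wd) → ∃ q : ℚ, q ≠ 0 ∧ (q : ℝ) = (W.regulator * W.bsdPeriod * ((W.modifiedTamagawaProduct : ℚ) : ℝ) / ((W.torsionOrder : ℕ) : ℝ) ^ 2) * (Wd.regulator * Wd.bsdPeriod * ((Wd.modifiedTamagawaProduct : ℚ) : ℝ) / ((Wd.torsionOrder : ℕ) : ℝ) ^ 2) / ((W.baseChange K).regulator * (W.baseChange K).bsdPeriod * (((W.baseChange K).modifiedTamagawaProduct : ℚ) : ℝ) / (((W.baseChange K).torsionOrder : ℕ) : ℝ) ^ 2) ∧ padicValRat 2 q = (padicValNat 2 Wd.tamagawaProduct : ℤ) - 1 := by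
  intro W _ _ _ hT hΔ K _ _ hK hodd _ hH hρ Dt β ι d₁ hy Wd _ _ hWd
  haveI hEK : (W.baseChange K).IsElliptic := by rw [WeierstrassCurve.baseChange]; infer_instance
  -- Kolyvagin: `rank E(K) = 1` from the non-torsion Heegner point under `P(1)`
  obtain ⟨P₀, hP₀, hP₀K⟩ := heegnerSystem_exists_isHeegnerPoint_map_eq_derivedPoint_one
    (heegnerPointOfConductor_one_galoisConj_holds (W.conductorNorm ℤ) W K) hK hH d₁
  have hPinf : ¬ IsOfFinAddOrder P₀ := by
    intro hfin
    apply hy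
    rw [← hP₀K]
    exact (WeierstrassCurve.Affine.Point.map (W' := W)
      (algebraMap K (ringClassField K ι 1)).toRatAlgHom).isOfFinAddOrder hfin
  obtain ⟨hrank, -⟩ := hKo (W.conductorNorm ℤ) W K hK hH hP₀ hPinf
  have hρ2 : W.HasSurjectiveModNGaloisRep 2 := by simpa using hρ 1 one_pos
  exact genusIndexLaw_of_rank_one W hT hΔ K hK hodd hH hρ2 hrank Wd hWd

end Summit.BirchSwinnertonDyer.BirchSwinnertonDyer.Theorems.GenusExact.PlusDescent

end
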